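import Summits.ResolutionOfSingularities.ResolutionOfSingularities.Theorems.HilbertSamuelEliminationSigmaMaxModificationsCorridor3WLadderIsoKernelCurveShadowOverring
import Summits.ResolutionOfSingularities.ResolutionOfSingularities.Theorems.HilbertSamuelEliminationSigmaMaxModificationsCorridor3WLadderIsoTowerQuadraticTransforms
import Summits.ResolutionOfSingularities.ResolutionOfSingularities.Theorems.HilbertSamuelEliminationSigmaMaxModificationsCorridor3WLadderIsoTailsFreeRationalArcLimit
import Summits.ResolutionOfSingularities.ResolutionOfSingularities.Theorems.HilbertSamuelEliminationSigmaMaxModificationsCorridor3WLadderIsoKernelCPSliceIntegral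
import Literature.AlgebraicGeometry.Resolution.TowerOverCurve
import Literature.AlgebraicGeometry.Resolution.StalkSpecializesLocalization
import HarnessLib

/-!
# [OURS · L1 W4.2] NO ISOLATED E3 POINT TOWER FOLLOWS A CURVE (kernel census for `stub_isoSepRecurrent` / `IsoQuadraticTowerTerminates p 3`):
# a point tower whose marked points lie on the strict transforms of a curve is eventually free-rational — and K1 kills it

Crux chain w42 (`SigmaMaxModifications`, stmt-ResolutionOfSingularities-18506; conjunct `SigmaMaxModificationsCorridor3`, stmt-…-19249),
line `w_ladder`, registered stub `stub_isoSepRecurrent` (K2-sep ∧ K3-sep) of skeleton v8.8. Lead res-L1-w42-lead-1 (gen 6), file 4/4 of the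
census (1 = `…IsoKernelKrullAkizukiFractions`, 2 = `…IsoKernelCurveShadowChain`, 3 = `…IsoKernelCurveShadowOverring`). Helper file
`--supports stmt-ResolutionOfSingularities-19249`; kernel only (no definition, no named fact).

WHAT IS PROVED.
* `exists_stalk_embeddings_all` — along a tower of blow-ups with integral stages, CANONICAL embeddings `Θ n y : 𝒪_{X_n,y} ↪ K(X_0)` of ALL
  stalks of all stages (`F_n ∘ (𝒪 ⊆ K(X_n))`, `F_{n+1} = F_n ∘ ε_{η_{n+1}}` with `ε` the tree's `IsBlowup.stalkEmb`), injective, compatible with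
  the stalk maps of the blow-ups and with specialization.
* `eventually_free_rational_of_curveShadow` — **A POINT TOWER FOLLOWING A CURVE IS EVENTUALLY FREE-RATIONAL**: tower of blow-ups, integral
  stages, POINT centres `{pt n}` (closed, `pt (n+1) ↦ pt n`), points `c n` with `c (n+1) ↦ c n`, `c n ⤳ pt n`, the prime `P` of `c 0` in
  `𝒪_{X_0,pt 0}` non-maximal and `dim 𝒪_{X_0,pt 0}⧸P ≤ 1` ⇒ from some `n₀` on `IsRationalStep T pt n ∧ ¬ IsSatelliteStep T pt n` (card C5's
  words). NO Hilbert–Samuel hypothesis. Proof: read everything in `K(X_0)`; the `𝒪_{X_n,c n}` have one common image `C` (blow-ups are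
  isomorphisms off the centre, `IsBlowup.isIso_stalkMap_of_not_mem_support'`), a local overring of the images `B n` of the `𝒪_{X_n,pt n}`, which
  form a chain of quadratic transforms along a valuation (res-L1-w42-lead-1 gen 5, `exists_valuation_forall_isQuadraticTransformAlong_of_pointTower`,
  p551840); `C = (B 0)_P` (`isLocalizationAtPrime_stalkSpecializes`); file 3's `eventually_free_rational_of_overring` (Krull–Akizuki) gives the
  element forms, transported back through `Θ`.
* `false_of_isIsoPointTower_of_curveShadow` (+ `_of_isIntegral`) — **NO ISOLATED E3 POINT TOWER OVER A MAXIMAL ORIGIN FOLLOWS A CURVE**: K1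
  (res-L1-w42-stub-2's `IsoTailsHS.isoFreeRationalTailsImpossible_holds`, p546901) kills the free-rational tail. Census reading for the kernel rows
  K2-sep / K3-sep / (k2): every hypothetical infinite isolated point tower is CURVE-FREE — its points leave the strict transforms of every curve
  through every `x_{n₀}`; valuatively, no dominating valuation is composite with a curve (the class «rank 2, `v = v_C ∘ v̄`» of the classical
  local-uniformization case analysis is empty here), whatever the field, the embedding dimension or the multiplicity.

HONEST FRAMING. OURS; K1 and the quadratic-transform dictionary are tree theorems; the commutative algebra is Krull–Akizuki. Nothing here is a
statement of H. Hironaka's manuscript [Hironaka2017] nor of [CossartJannsenSaito2020] / [CossartPiltant2009]. AI-written; AI review is weaker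
than expert review.
References: J. Kollár, *Lectures on Resolution of Singularities* (2007), §1.4 [Kollar2007]; O. Zariski, P. Samuel, *Commutative Algebra* II,
App. 5 [ZariskiSamuel1960]; V. Cossart, O. Piltant, J. Algebra 321 (2009), ch. 3 I.9 [CossartPiltant2009]; H. Matsumura, Thm. 11.7 [Matsumura1987].
-/

noncomputable section

set_option linter.dupNamespace false

open IsLocalRing
open Literature.AlgebraicGeometry.Resolution

namespace Summit.ResolutionOfSingularities.ResolutionOfSingularities.Cruxes.SigmaMaxModifications.IdeasL1C5

universe u

/-! ## §5. SCHEME LEVEL: canonical compatible stalk embeddings along an integral tower of blow-ups -/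

section Scheme

open AlgebraicGeometry CategoryTheory TopologicalSpace
open Literature.AlgebraicGeometry.CossartJannsenSaito2020

variable {T : BlowupTower.{u}}

/-- **CANONICAL COMPATIBLE STALK EMBEDDINGS OF ALL STALKS OF ALL STAGES into the function field of the bottom stage** of a tower of blow-ups
with integral stages: `Θ n y : 𝒪_{X_n,y} ↪ K(X_0)`, `Θ n y = F_n ∘ (𝒪_{X_n,y} ⊆ K(X_n))` with `F_{n+1} = F_n ∘ ε_{η_{n+1}}` (`ε` = `IsBlowup.stalkEmb` at
the generic point); injective, compatible with the stalk maps of the blow-ups (`Θ (n+1) y' ∘ π_n^♯ = Θ n (π_n y')`) and with specialization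
(`Θ n y ∘ (𝒪_{X_n,z} → 𝒪_{X_n,y}) = Θ n z` for `y ⤳ z`). [cite: Kollar2007, §1.4] [cite: Cutkosky2014, §2.1] -/
theorem exists_stalk_embeddings_all (hint : ∀ n, IsIntegral (T.X n)) :
    ∃ Θ : ∀ n (y : T.X n), (T.X n).presheaf.stalk y →+* (T.X 0).functionField,
      (∀ n y, Function.Injective (Θ n y)) ∧
      (∀ n (y' : T.X (n + 1)), (Θ (n + 1) y').comp ((T.π n).stalkMap y').hom = Θ n ((T.π n).base y')) ∧
      (∀ n (y z : T.X n) (h : y ⤳ z), (Θ n y).comp ((T.X n).presheaf.stalkSpecializes h).hom = Θ n z) := by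
  haveI := hint
  haveI := fun n => T.ln n
  -- the field maps `F n : K(X_n) → K(X_0)`
  let F : ∀ n, (T.X n).functionField →+* (T.X 0).functionField := fun n =>
    Nat.rec (motive := fun n => (T.X n).functionField →+* (T.X 0).functionField) (RingHom.id _)
      (fun n Fn => Fn.comp ((T.isBlowup n).stalkEmb (genericPoint (T.X (n + 1))))) n
  have hF0 : F 0 = RingHom.id _ := rfl
  have hFs : ∀ n, F (n + 1) = (F n).comp ((T.isBlowup n).stalkEmb (genericPoint (T.X (n + 1)))) := fun n => rfl
  refine ⟨fun n y => (F n).comp (algebraMap ((T.X n).presheaf.stalk y) (T.X n).functionField), fun n y => ?_, fun n y' => ?_,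
    fun n y z h => ?_⟩
  · exact (F n).injective.comp (IsFractionRing.injective ((T.X n).presheaf.stalk y) (T.X n).functionField)
  · change ((F (n + 1)).comp _).comp _ = (F n).comp _
    rw [hFs, RingHom.comp_assoc, RingHom.comp_assoc]
    congr 1
    have hε : ((T.isBlowup n).stalkEmb (genericPoint (T.X (n + 1)))).comp
        (algebraMap ((T.X (n + 1)).presheaf.stalk y') (T.X (n + 1)).functionField) = (T.isBlowup n).stalkEmb y' :=
      (T.isBlowup n).stalkEmb_comp_stalkSpecializes ((genericPoint_spec (T.X (n + 1))).specializes trivial)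
    rw [← RingHom.comp_assoc, hε, (T.isBlowup n).stalkEmb_comp_stalkMap]
  · change ((F n).comp _).comp _ = (F n).comp _
    rw [RingHom.comp_assoc, algebraMap_comp_stalkSpecializes h]


/-- Membership in the maximal ideal of a local subring of a field, transported along an equality of subrings. [folklore] -/
theorem mem_maximalIdeal_subring_congr {L : Type u} [Field L] {S₁ S₂ : Subring L} [IsLocalRing S₁] [IsLocalRing S₂]
    (h : S₁ = S₂) {z : L} (h₁ : z ∈ S₁) (h₂ : z ∈ S₂) :
    (⟨z, h₁⟩ : S₁) ∈ maximalIdeal S₁ ↔ (⟨z, h₂⟩ : S₂) ∈ maximalIdeal S₂ := by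
  subst h; rfl

variable {pt : ∀ n, T.X n}

/-- **A POINT TOWER FOLLOWING A CURVE IS EVENTUALLY FREE-RATIONAL.** A tower of blow-ups `T` with integral stages, POINT centres
`C_n = {pt n}` (closed), `pt (n+1) ↦ pt n`; points `c n ∈ X_n` with `c (n+1) ↦ c n`, `c n ⤳ pt n` (the marked points lie on the strict
transforms `cl{c n}` of `cl{c 0}`), `c 0 ≠ pt 0` in the strong form «the prime `P` of `c 0` in `𝒪_{X_0,pt 0}` is not maximal», and
`dim 𝒪_{X_0,pt 0}⧸P ≤ 1` (`cl{c 0}` IS A CURVE at `pt 0`). Then from some `n₀` on every step is RATIONAL and NOT SATELLITE (`IsRationalStep`,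
`¬ IsSatelliteStep` of card C5). Proof: read all stalks in `K(X_0)` (`exists_stalk_embeddings_all`); the stalks `𝒪_{X_n,c n}` all have the same
image `C` (blow-ups are isomorphisms off the centre), a local overring of the images `B n` of the `𝒪_{X_n,pt n}`, which form a dominating chain of
quadratic transforms (res-L1-w42-lead-1 gen 5, `exists_valuation_forall_isQuadraticTransformAlong_of_pointTower`); apply the subring form
`eventually_free_rational_of_overring` and transport back. No Hilbert–Samuel hypothesis is used: ANY point tower shadowed by a curve is eventually
free-rational. [cite: Kollar2007, §1.4] [cite: Matsumura1987, Thm. 11.7] [cite: ZariskiSamuel1960, App. 5] -/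
theorem eventually_free_rational_of_curveShadow (hint : ∀ n, IsIntegral (T.X n))
    (hC : ∀ n, T.C n = {pt n}) (hpt : ∀ n, (T.π n).base (pt (n + 1)) = pt n) (hcl : ∀ n, IsClosed ({pt n} : Set (T.X n)))
    (c : ∀ n, T.X n) (hc : ∀ n, (T.π n).base (c (n + 1)) = c n) (hcs : ∀ n, c n ⤳ pt n)
    (hP : (maximalIdeal ((T.X 0).presheaf.stalk (c 0))).comap ((T.X 0).presheaf.stalkSpecializes (hcs 0)).hom ≠
      maximalIdeal ((T.X 0).presheaf.stalk (pt 0)))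
    (hcurve : Ring.KrullDimLE 1 ((T.X 0).presheaf.stalk (pt 0) ⧸
      (maximalIdeal ((T.X 0).presheaf.stalk (c 0))).comap ((T.X 0).presheaf.stalkSpecializes (hcs 0)).hom)) :
    ∃ n₀, ∀ n, n₀ ≤ n → IsRationalStep T pt n ∧ ¬ IsSatelliteStep T pt n := by
  classical
  haveI := hint
  haveI := fun n => T.ln n
  obtain ⟨Θ, hΘinj, hΘmap, hΘsp⟩ := exists_stalk_embeddings_all (T := T) hint
  -- the chain `B n = Θ (𝒪_{X_n, pt n})`
  have hcomp : ∀ n, (Θ (n + 1) (pt (n + 1))).comp ((T.π n).stalkMap (pt (n + 1))).hom =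
      (Θ n (pt n)).comp ((T.X n).presheaf.stalkCongr (.of_eq (hpt n))).hom.hom := fun n => by
    rw [hΘmap, TopCat.Presheaf.stalkCongr_hom]
    exact (hΘsp n (pt n) ((T.π n).base (pt (n + 1))) (Inseparable.of_eq (hpt n)).ge).symm
  set B : ℕ → Subring (T.X 0).functionField := fun n => (Θ n (pt n)).range with hBdef
  haveI hBloc : ∀ n, IsLocalRing (B n) := fun n => isLocalRing_of_range_eq (Θ n (pt n)) _ rfl
  have hdom : ∀ n, SubringDominates (B n) (B (n + 1)) :=
    subringDominates_range_succ hpt (fun n => Θ n (pt n)) (fun n => hΘinj n _) hcomp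
  obtain ⟨O, -, hQT⟩ := exists_valuation_forall_isQuadraticTransformAlong_of_pointTower hpt (fun n => Θ n (pt n)) hint hC hcl
    (fun n => hΘinj n _) hcomp
  have hprin : ∀ n, ∃ t ∈ maximalIdeal (B n), ∀ x ∈ maximalIdeal (B n), ∃ y : B (n + 1), (x : (T.X 0).functionField) = y * t := by
    intro n
    obtain ⟨_, hLB⟩ := hQT n
    obtain ⟨u₀, hu₀, hgen⟩ := hLB.exists_span_singleton
    exact ⟨u₀, hu₀, fun x hx => by obtain ⟨y, hy, hxy⟩ := hgen x hx; exact ⟨⟨y, hy⟩, hxy⟩⟩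
  -- the curve: `c n ≠ pt n`, the stalk maps at `c (n+1)` are isomorphisms, one common local ring `C`
  have hcne : ∀ n, c n ≠ pt n := by
    intro n
    induction n with
    | zero =>
      intro h
      apply hP
      have key : ∀ (y : T.X 0) (hy : y ⤳ pt 0), y = pt 0 →
          (maximalIdeal ((T.X 0).presheaf.stalk y)).comap ((T.X 0).presheaf.stalkSpecializes hy).hom =
            maximalIdeal ((T.X 0).presheaf.stalk (pt 0)) := by
        intro y hy e
        subst e
        rw [TopCat.Presheaf.stalkSpecializes_refl]
        exact Ideal.comap_id _
      exact key (c 0) (hcs 0) h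
    | succ n ih =>
      intro h
      apply ih
      rw [← hc n, h, hpt n]
  have hsurj : ∀ n, Function.Surjective ((T.π n).stalkMap (c (n + 1))).hom := by
    intro n
    haveI : IsIso ((T.π n).stalkMap (c (n + 1))) := by
      refine (T.isBlowup n).isIso_stalkMap_of_not_mem_support' ?_
      rw [← SetLike.mem_coe, Scheme.IdealSheafData.coe_support_vanishingIdeal]
      change (T.π n).base (c (n + 1)) ∉ T.C n
      rw [hC n, hc n]
      exact hcne n
    exact (ConcreteCategory.bijective_of_isIso ((T.π n).stalkMap (c (n + 1)))).2
  set C : Subring (T.X 0).functionField := (Θ 0 (c 0)).range with hCdef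
  haveI hCloc : IsLocalRing C := isLocalRing_of_range_eq (Θ 0 (c 0)) _ rfl
  have hCn : ∀ n, (Θ n (c n)).range = C := by
    intro n
    induction n with
    | zero => rfl
    | succ n ih =>
      rw [← ih, ← hc n, ← hΘmap n (c (n + 1))]
      ext z
      constructor
      · rintro ⟨a, rfl⟩
        obtain ⟨b, rfl⟩ := hsurj n a
        exact ⟨b, rfl⟩
      · rintro ⟨b, rfl⟩
        exact ⟨_, rfl⟩
  have hBC : ∀ n, B n ≤ C := by
    intro n
    rw [← hCn n]
    rintro _ ⟨a, rfl⟩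
    rw [← hΘsp n (c n) (pt n) (hcs n)]
    exact ⟨_, rfl⟩
  -- dictionary between stalks and images
  haveI hrangeLoc : ∀ n (y : T.X n), IsLocalRing (Θ n y).range := fun n y => isLocalRing_of_range_eq (Θ n y) _ rfl
  have hmax : ∀ n (y : T.X n) (a : (T.X n).presheaf.stalk y),
      a ∈ maximalIdeal _ ↔ (⟨Θ n y a, ⟨a, rfl⟩⟩ : (Θ n y).range) ∈ maximalIdeal (Θ n y).range :=
    fun n y a => mem_maximalIdeal_iff_range (Θ n y) (hΘinj n y) a
  -- the prime `P` of the curve at `pt 0` and the localization `𝒪_{X_0, c 0} = (𝒪_{X_0, pt 0})_P`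
  set sp := ((T.X 0).presheaf.stalkSpecializes (hcs 0)).hom with hsp
  set P : Ideal ((T.X 0).presheaf.stalk (pt 0)) := (maximalIdeal ((T.X 0).presheaf.stalk (c 0))).comap sp with hPdef
  have hspΘ : ∀ f, Θ 0 (c 0) (sp f) = Θ 0 (pt 0) f := fun f => RingHom.congr_fun (hΘsp 0 (c 0) (pt 0) (hcs 0)) f
  have hinclΘ : ∀ f, Subring.inclusion (hBC 0) ⟨Θ 0 (pt 0) f, ⟨f, rfl⟩⟩ = ⟨Θ 0 (c 0) (sp f), ⟨sp f, rfl⟩⟩ :=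
    fun f => Subtype.ext (hspΘ f).symm
  have hPiff : ∀ f, f ∈ P ↔ Subring.inclusion (hBC 0) ⟨Θ 0 (pt 0) f, ⟨f, rfl⟩⟩ ∈ maximalIdeal C := fun f => by
    rw [hPdef, Ideal.mem_comap, hmax 0 (c 0), hinclΘ]
  -- (a) the curve is not the point
  have hsep : ∃ x ∈ maximalIdeal (B 0), Subring.inclusion (hBC 0) x ∉ maximalIdeal C := by
    have hPle : P ≤ maximalIdeal _ := IsLocalRing.le_maximalIdeal (Ideal.IsPrime.ne_top (Ideal.comap_isPrime _ _))
    obtain ⟨f, hf, hfP⟩ := SetLike.exists_of_lt (lt_of_le_of_ne hPle hP)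
    exact ⟨⟨Θ 0 (pt 0) f, ⟨f, rfl⟩⟩, (hmax 0 (pt 0) f).mp hf, fun h => hfP ((hPiff f).mpr h)⟩
  -- (b) `C` consists of fractions of `B 0` with denominators units of `C`
  have hfracC : ∀ z : C, ∃ a b : B 0, Subring.inclusion (hBC 0) b ∉ maximalIdeal C ∧ (z : (T.X 0).functionField) * b = a := by
    rintro ⟨_, w, rfl⟩
    letI := sp.toAlgebra
    haveI : IsLocalization.AtPrime ((T.X 0).presheaf.stalk (c 0)) P := isLocalizationAtPrime_stalkSpecializes (hcs 0)
    obtain ⟨⟨a, s⟩, rfl⟩ := IsLocalization.mk'_surjective P.primeCompl w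
    refine ⟨⟨Θ 0 (pt 0) a, ⟨a, rfl⟩⟩, ⟨Θ 0 (pt 0) s, ⟨(s : (T.X 0).presheaf.stalk (pt 0)), rfl⟩⟩, fun h => s.2 ((hPiff s).mpr h), ?_⟩
    change Θ 0 (c 0) (IsLocalization.mk' _ a s) * Θ 0 (pt 0) s = Θ 0 (pt 0) a
    rw [← hspΘ, ← hspΘ, ← map_mul]
    congr 1
    exact IsLocalization.mk'_spec _ a s
  -- (c) the curve has dimension one: transport along `𝒪_{X_0,pt 0} ≃ B 0`
  let e : (T.X 0).presheaf.stalk (pt 0) ≃+* B 0 :=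
    RingEquiv.ofBijective (Θ 0 (pt 0)).rangeRestrict ⟨fun x y h => hΘinj 0 _ (congrArg Subtype.val h), (Θ 0 (pt 0)).rangeRestrict_surjective⟩
  have he : ∀ f, e f = ⟨Θ 0 (pt 0) f, ⟨f, rfl⟩⟩ := fun f => rfl
  set Q : Ideal (B 0) := (maximalIdeal C).comap (Subring.inclusion (hBC 0)) with hQdef
  have hPQ : P = Q.comap (e : (T.X 0).presheaf.stalk (pt 0) →+* B 0) := by
    ext f
    rw [hPiff, Ideal.mem_comap, hQdef, Ideal.mem_comap]
    rfl
  haveI : IsNoetherianRing (B 0) := isNoetherianRing_of_ringEquiv _ e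
  have hdim : Ring.KrullDimLE 1 (B 0 ⧸ Q) := by
    have hQe : Q = Ideal.map (e : (T.X 0).presheaf.stalk (pt 0) →+* B 0) P := by
      rw [hPQ]; exact (Ideal.map_comap_of_surjective (e : (T.X 0).presheaf.stalk (pt 0) →+* B 0) e.surjective Q).symm
    let eq : ((T.X 0).presheaf.stalk (pt 0) ⧸ P) ≃+* (B 0 ⧸ Q) := Ideal.quotientEquiv P Q e hQe
    rw [Ring.krullDimLE_iff] at hcurve ⊢
    rwa [← ringKrullDim_eq_of_ringEquiv eq]
  -- the subring-level theorem
  obtain ⟨n₀, hn₀⟩ := eventually_free_rational_of_overring hdom C hBC hprin hsep hfracC hdim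
  refine ⟨n₀, fun n hn => ?_⟩
  obtain ⟨⟨t, ht, hgen⟩, hres⟩ := hn₀ n hn
  -- ranges at the image points
  have hB1 : (Θ (n + 1) ((T.π (n + 1)).base (pt (n + 2)))).range = B (n + 1) := by
    change _ = (Θ (n + 1) (pt (n + 1))).range; rw [hpt (n + 1)]
  have hB0' : (Θ n ((T.π n).base (pt (n + 1)))).range = B n := by
    change _ = (Θ n (pt n)).range; rw [hpt n]
  have hB0 : (Θ n ((T.π n).base ((T.π (n + 1)).base (pt (n + 2))))).range = B n := by
    change _ = (Θ n (pt n)).range; rw [hpt (n + 1), hpt n]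
  constructor
  · -- RATIONAL: `κ(pt n) → κ(pt (n+1))` is onto
    change Function.Surjective (IsLocalRing.ResidueField.map ((T.π n).stalkMap (pt (n + 1))).hom)
    intro r
    obtain ⟨yt, rfl⟩ := IsLocalRing.residue_surjective r
    set yB : B (n + 1) := ⟨Θ (n + 1) (pt (n + 1)) yt, ⟨yt, rfl⟩⟩ with hyB
    obtain ⟨x, hx⟩ := hres yB
    obtain ⟨xt, hxt⟩ : (x : (T.X 0).functionField) ∈ (Θ n ((T.π n).base (pt (n + 1)))).range := by
      rw [hB0']; exact x.2
    refine ⟨IsLocalRing.residue _ xt, ?_⟩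
    rw [IsLocalRing.ResidueField.map_residue, ← sub_eq_zero, ← map_sub, IsLocalRing.residue_eq_zero_iff,
      hmax (n + 1) (pt (n + 1))]
    have hΘx : Θ (n + 1) (pt (n + 1)) (((T.π n).stalkMap (pt (n + 1))).hom xt) = x := by
      rw [← hxt]; exact RingHom.congr_fun (hΘmap n (pt (n + 1))) xt
    have hel : (⟨Θ (n + 1) (pt (n + 1)) (((T.π n).stalkMap (pt (n + 1))).hom xt - yt), ⟨_, rfl⟩⟩ :
        (Θ (n + 1) (pt (n + 1))).range) = -(yB - Subring.inclusion (hdom n).1 x) := by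
      apply Subtype.ext
      change Θ (n + 1) (pt (n + 1)) (((T.π n).stalkMap (pt (n + 1))).hom xt - yt) =
        -((Θ (n + 1) (pt (n + 1)) yt) - (x : (T.X 0).functionField))
      rw [map_sub, hΘx]; ring
    rw [hel]
    exact neg_mem hx
  · -- NOT SATELLITE: `𝔪_{x_n}·𝒪_{x_{n+2}} = 𝔪_{x_{n+1}}·𝒪_{x_{n+2}}`
    intro hsat
    apply hsat
    set y₁ := (T.π (n + 1)).base (pt (n + 2)) with hy₁
    set y₀ := (T.π n).base y₁ with hy₀
    set sm₁ := ((T.π (n + 1)).stalkMap (pt (n + 2))).hom with hsm₁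
    set sm₀ := ((T.π n).stalkMap y₁).hom with hsm₀
    have hcompst : ((T.π (n + 1) ≫ T.π n).stalkMap (pt (n + 2))).hom = sm₁.comp sm₀ := by
      rw [hsm₁, hsm₀, Scheme.Hom.stalkMap_comp]
      rfl
    have hLHS : Ideal.map ((T.π (n + 1) ≫ T.π n).stalkMap (pt (n + 2))).hom (maximalIdeal _) =
        ((maximalIdeal ((T.X n).presheaf.stalk y₀)).map sm₀).map sm₁ := by
      rw [Ideal.map_map, ← hcompst]
      exact rfl
    rw [hLHS]
    apply le_antisymm
    · exact Ideal.map_mono (IsLocalRing.map_maximalIdeal_le sm₀)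
    · rw [Ideal.map_le_iff_le_comap]
      intro g hg
      rw [Ideal.mem_comap]
      -- `g ∈ 𝔪_{x_{n+1}}` read in `B (n+1)`, then `Θ g = yv * t`
      have hgB : (⟨Θ (n + 1) y₁ g, by rw [← hB1]; exact ⟨g, rfl⟩⟩ : B (n + 1)) ∈ maximalIdeal (B (n + 1)) := by
        rw [← mem_maximalIdeal_subring_congr hB1 ⟨g, rfl⟩]
        exact (hmax (n + 1) y₁ g).mp hg
      obtain ⟨yv, hyv⟩ := hgen _ hgB
      change Θ (n + 1) y₁ g = (yv : (T.X 0).functionField) * t at hyv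
      -- `t = Θ tt` with `tt ∈ 𝔪_{x_n}`, `yv = Θ yt`
      obtain ⟨tt, htt⟩ : (t : (T.X 0).functionField) ∈ (Θ n y₀).range := by rw [hB0]; exact t.2
      have httm : tt ∈ maximalIdeal _ := by
        rw [hmax n y₀ tt, mem_maximalIdeal_subring_congr hB0 ⟨tt, rfl⟩ (by rw [htt]; exact t.2)]
        have : (⟨Θ n y₀ tt, by rw [htt]; exact t.2⟩ : B n) = t := Subtype.ext htt
        rw [this]; exact ht
      obtain ⟨yt, hyt⟩ : (yv : (T.X 0).functionField) ∈ (Θ (n + 2) (pt (n + 2))).range := yv.2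
      have h1 : Θ (n + 2) (pt (n + 2)) (sm₁ g) = Θ (n + 1) y₁ g := RingHom.congr_fun (hΘmap (n + 1) (pt (n + 2))) g
      have h2a : Θ (n + 2) (pt (n + 2)) (sm₁ (sm₀ tt)) = Θ (n + 1) y₁ (sm₀ tt) :=
        RingHom.congr_fun (hΘmap (n + 1) (pt (n + 2))) (sm₀ tt)
      have h2b : Θ (n + 1) y₁ (sm₀ tt) = Θ n y₀ tt := RingHom.congr_fun (hΘmap n y₁) tt
      have h2 : Θ (n + 2) (pt (n + 2)) (sm₁ (sm₀ tt)) = Θ n y₀ tt := h2a.trans h2b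
      have hkey : sm₁ g = yt * sm₁ (sm₀ tt) := hΘinj (n + 2) (pt (n + 2)) (by rw [map_mul, h1, h2, hyt, htt, hyv])
      rw [hkey]
      exact Ideal.mul_mem_left _ _ (Ideal.mem_map_of_mem _ (Ideal.mem_map_of_mem _ httm))

open Summit.ResolutionOfSingularities.ResolutionOfSingularities.Theorems.CampaignW42 (IsMaximalOrigin)
open Summit.ResolutionOfSingularities.ResolutionOfSingularities.Cruxes.SigmaMaxModifications.IdeasL1Idea2R4 (IsIsoPointTower)
open Summit.ResolutionOfSingularities.ResolutionOfSingularities.Theorems.SigmaMaxModificationsCorridor3 (IsoTailsHS.isoFreeRationalTailsImpossible_holds)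

/-- **NO ISOLATED E3 POINT TOWER FOLLOWS A CURVE** (kernel census, stub `stub_isoSepRecurrent` territory: the K2/K3 rows are EMPTY on curve
shadows). An isolated E3 point tower (`IsIsoPointTower 3 ν T pt`) over a maximal origin of characteristic `p` at level `3`, with integral stages,
cannot have its marked points on the strict transforms of a curve through the origin: `c n ∈ X_n`, `c (n+1) ↦ c n`, `c n ⤳ pt n`, the prime of
`c 0` in `𝒪_{X_0, pt 0}` non-maximal with one-dimensional quotient. By `eventually_free_rational_of_curveShadow` such a tower is eventually
free-rational, and K1 (res-L1-w42-stub-2's `IsoTailsHS.isoFreeRationalTailsImpossible_holds`, p546901: free-rational tails of isolated towers are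
the infinitely near points of a smooth formal arc inside `X(ν)^`, impossible at an HS-isolated point) kills it. Valuative reading: no valuation ring
dominating the tower is COMPOSITE WITH A CURVE through the origin (rank-two valuations `v = v_C ∘ v̄` are excluded whatever `v̄` is).
[cite: CossartPiltant2009, ch. 3 I.9] [cite: ZariskiSamuel1960, App. 5] [cite: Kollar2007, §1.4] -/
theorem false_of_isIsoPointTower_of_curveShadow {p : ℕ} {ν : ℕ → ℕ} (hint : ∀ n, IsIntegral (T.X n))
    (hO : IsMaximalOrigin p 3 ν (T.X 0) (pt 0)) (hT : IsIsoPointTower 3 ν T pt)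
    (c : ∀ n, T.X n) (hc : ∀ n, (T.π n).base (c (n + 1)) = c n) (hcs : ∀ n, c n ⤳ pt n)
    (hP : (maximalIdeal ((T.X 0).presheaf.stalk (c 0))).comap ((T.X 0).presheaf.stalkSpecializes (hcs 0)).hom ≠
      maximalIdeal ((T.X 0).presheaf.stalk (pt 0)))
    (hcurve : Ring.KrullDimLE 1 ((T.X 0).presheaf.stalk (pt 0) ⧸
      (maximalIdeal ((T.X 0).presheaf.stalk (c 0))).comap ((T.X 0).presheaf.stalkSpecializes (hcs 0)).hom)) : False :=
  IsoTailsHS.isoFreeRationalTailsImpossible_holds p ν T pt hO hT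
    (eventually_free_rational_of_curveShadow hint hT.1 hT.2.1 hT.2.2.1 c hc hcs hP hcurve)

/-- … with only the ORIGIN stage assumed integral and the marked points singular (then every stage is integral,
`isIntegral_of_pointTower`, p559739). [cite: CossartPiltant2009, ch. 3 I.9] [cite: StacksProject, Tag 02ND] -/
theorem false_of_isIsoPointTower_of_curveShadow_of_isIntegral {p : ℕ} {ν : ℕ → ℕ} (hint0 : IsIntegral (T.X 0))
    (hsing : ∀ n, ¬ IsRegularLocalRing ((T.X n).presheaf.stalk (pt n)))
    (hO : IsMaximalOrigin p 3 ν (T.X 0) (pt 0)) (hT : IsIsoPointTower 3 ν T pt)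
    (c : ∀ n, T.X n) (hc : ∀ n, (T.π n).base (c (n + 1)) = c n) (hcs : ∀ n, c n ⤳ pt n)
    (hP : (maximalIdeal ((T.X 0).presheaf.stalk (c 0))).comap ((T.X 0).presheaf.stalkSpecializes (hcs 0)).hom ≠
      maximalIdeal ((T.X 0).presheaf.stalk (pt 0)))
    (hcurve : Ring.KrullDimLE 1 ((T.X 0).presheaf.stalk (pt 0) ⧸
      (maximalIdeal ((T.X 0).presheaf.stalk (c 0))).comap ((T.X 0).presheaf.stalkSpecializes (hcs 0)).hom)) : False :=
  false_of_isIsoPointTower_of_curveShadow (isIntegral_of_pointTower hint0 hT.1 hT.2.2.1 hsing) hO hT c hc hcs hP hcurve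

end Scheme
end Summit.ResolutionOfSingularities.ResolutionOfSingularities.Cruxes.SigmaMaxModifications.IdeasL1C5

end
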